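import Mathlib.Analysis.SpecialFunctions.SmoothTransition
import Mathlib.Analysis.SpecialFunctions.Pow.Real
import Mathlib.Analysis.SpecialFunctions.Exp
import HarnessLib

/-!
# BF18 shell for functions (crux `ChaosClosesEuler`, stmt-AtomisticToContinuum-15141, line `Sketch`,
# stub `stub_bf18Shell`) — assembly helper: the order of choices of the Grönwall parameters `u, Δ₀, A₀`

WHAT. `stub_bf18ShellParam`: the windowed Grönwall lemma of the shell bounds the window average of the
relative energy by `Δ · Γ(u, Δ, A)` with
`Γ(u, Δ, A) = Q(u) · (A + C · B_I(Δ, A)) + C₂ · u`, `Q(u) = 2 + 1/(1 − ζ(1−u)) + 1/ζ(u)`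
(`ζ = Real.smoothTransition`), `B_I(Δ, A) = (C₂Δ + t(A + C·C₂·Δ))·e^{Ct} + C₂Δ` (`C ≥ 0` the Grönwall rate,
`C₂ ≥ 0` the a-priori bound, `A ≥ 0` the initial-plus-defect term), and the final `L¹` error of the shell is
`L · (Γ + √Γ)`. Given `ε > 0` we CHOOSE, in this order, `u ∈ (0,1)` (killing `C₂ u`), then `Δ₀ ∈ (0, t/4]`
(killing the `Δ`-terms of `B_I`), then, for each `0 < Δ ≤ Δ₀`, a threshold `A₀ > 0` (killing the `A`-terms),
such that `0 ≤ Γ` and `L · (Γ + √Γ) ≤ ε` whenever `0 ≤ A ≤ A₀`.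

WHY / PROOF. Put `δ = ε / L` and `γ = min (δ/2) ((δ/2)²) > 0`; if `Γ ≤ γ` then `Γ ≤ δ/2` and
`√Γ ≤ √((δ/2)²) = δ/2`, so `L(Γ + √Γ) ≤ Lδ = ε` (`exists_budget`). Expanding `B_I`,
`Γ = Q·(1 + C t e^{Ct})·A + Q·C·C₂·((1 + tC)e^{Ct} + 1)·Δ + C₂ u` (`gamma_expand`), a sum of three
non-negative terms, each made `≤ γ/4` (`piece_le`) by the choices `u = min (1/2) (γ/(4(C₂+1)))`,
`Δ₀ = min (t/4) (γ/(4(K_Δ + 1)))`, `A₀ = γ/(4(K_A + 1))` (`tail_choice`), where `Q = Q(u) > 0` because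
`0 < ζ(u)` and `ζ(1−u) < 1` for `u ∈ (0,1)` (`bracket_pos`).

No named fact is invoked.
-/

namespace Summit.AtomisticToContinuum.HydrodynamicLimit.Theorems.ChaosClosesEulerShellParam

/-- The bracket `Q(u) = 2 + 1/(1 − ζ(1−u)) + 1/ζ(u)` of the windowed Grönwall lemma is positive for
`u ∈ (0,1)`. [folklore] -/
theorem bracket_pos {u : ℝ} (hu0 : 0 < u) (hu1 : u < 1) :
    0 < 2 + 1 / (1 - Real.smoothTransition (1 - u)) + 1 / Real.smoothTransition u := by
  have h1 : Real.smoothTransition (1 - u) < 1 := Real.smoothTransition.lt_one_of_lt_one (by linarith)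
  have h2 : 0 < 1 / (1 - Real.smoothTransition (1 - u)) := one_div_pos.2 (sub_pos.2 h1)
  have h3 : 0 < 1 / Real.smoothTransition u := one_div_pos.2 (Real.smoothTransition.pos_of_pos hu0)
  linarith

/-- The square-root budget: if `x ≤ min (δ/2) ((δ/2)²)` with `δ ≥ 0` then `x + √x ≤ δ`. [folklore] -/
theorem add_sqrt_le {x δ : ℝ} (hδ : 0 ≤ δ) (hx : x ≤ min (δ / 2) ((δ / 2) ^ 2)) :
    x + Real.sqrt x ≤ δ := by
  have h1 : x ≤ δ / 2 := hx.trans (min_le_left _ _)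
  have h2 : Real.sqrt x ≤ δ / 2 := by
    rw [Real.sqrt_le_left (by positivity)]
    exact hx.trans (min_le_right _ _)
  linarith

/-- The `L¹` budget: for `L, ε > 0` there is `γ > 0` with `L · (x + √x) ≤ ε` whenever `x ≤ γ`. [folklore] -/
theorem exists_budget {L ε : ℝ} (hL : 0 < L) (hε : 0 < ε) :
    ∃ γ : ℝ, 0 < γ ∧ ∀ x : ℝ, x ≤ γ → L * (x + Real.sqrt x) ≤ ε := by
  have hδ : 0 < ε / L := div_pos hε hL
  refine ⟨min (ε / L / 2) ((ε / L / 2) ^ 2), lt_min (by positivity) (by positivity), fun x hx => ?_⟩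
  calc L * (x + Real.sqrt x) ≤ L * (ε / L) := mul_le_mul_of_nonneg_left (add_sqrt_le hδ.le hx) hL.le
    _ = ε := by field_simp

/-- One piece of the budget: `0 ≤ M` and `0 ≤ x ≤ γ/(4(M+1))` give `M · x ≤ γ/4`. [folklore] -/
theorem piece_le {M γ x : ℝ} (hM : 0 ≤ M) (hx0 : 0 ≤ x) (hx : x ≤ γ / (4 * (M + 1))) :
    M * x ≤ γ / 4 := by
  have h1 : (0 : ℝ) < 4 * (M + 1) := by positivity
  have h2 : x * (4 * (M + 1)) ≤ γ := (le_div_iff₀ h1).1 hx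
  nlinarith

/-- Expansion of `Γ = Q·(A + C·B_I) + c₀` in the small parameters `A` and `Δ`:
`Γ = Q(1 + C t E)·A + Q·C·C₂·((1 + tC)E + 1)·Δ + c₀`. [folklore] -/
theorem gamma_expand (Q A C C₂ Δ t E c₀ : ℝ) :
    Q * (A + C * ((C₂ * Δ + t * (A + C * C₂ * Δ)) * E + C₂ * Δ)) + c₀ =
      Q * (1 + C * t * E) * A + Q * (C * C₂ * ((1 + t * C) * E + 1)) * Δ + c₀ := by
  ring

/-- The choices of `Δ₀` and `A₀` at a fixed bracket `Q > 0`, exponential factor `E > 0` and constant term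
`0 ≤ c₀ ≤ γ/4`: `Δ₀ = min (t/4) (γ/(4(K_Δ+1)))` and `A₀ = γ/(4(K_A+1))` with `K_A = Q(1 + C t E)`,
`K_Δ = Q·C·C₂·((1 + tC)E + 1)` make `0 ≤ Γ ≤ γ`. [folklore] -/
theorem tail_choice {Q E t C C₂ γ c₀ : ℝ} (hQ : 0 < Q) (hE : 0 < E) (ht : 0 < t) (hC : 0 ≤ C)
    (hC₂ : 0 ≤ C₂) (hγ : 0 < γ) (hc₀ : 0 ≤ c₀) (hcγ : c₀ ≤ γ / 4) :
    ∃ Δ₀ : ℝ, 0 < Δ₀ ∧ 4 * Δ₀ ≤ t ∧ ∀ Δ : ℝ, 0 < Δ → Δ ≤ Δ₀ → ∃ A₀ : ℝ, 0 < A₀ ∧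
      ∀ A : ℝ, 0 ≤ A → A ≤ A₀ →
        0 ≤ Q * (A + C * ((C₂ * Δ + t * (A + C * C₂ * Δ)) * E + C₂ * Δ)) + c₀ ∧
        Q * (A + C * ((C₂ * Δ + t * (A + C * C₂ * Δ)) * E + C₂ * Δ)) + c₀ ≤ γ := by
  have hKA : 0 ≤ Q * (1 + C * t * E) := by positivity
  have hKΔ : 0 ≤ Q * (C * C₂ * ((1 + t * C) * E + 1)) := by positivity
  refine ⟨min (t / 4) (γ / (4 * (Q * (C * C₂ * ((1 + t * C) * E + 1)) + 1))),
    lt_min (by positivity) (by positivity), ?_, fun Δ hΔ hΔ₀ => ?_⟩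
  · linarith [min_le_left (t / 4) (γ / (4 * (Q * (C * C₂ * ((1 + t * C) * E + 1)) + 1)))]
  have hΔγ : Q * (C * C₂ * ((1 + t * C) * E + 1)) * Δ ≤ γ / 4 :=
    piece_le hKΔ hΔ.le (hΔ₀.trans (min_le_right _ _))
  refine ⟨γ / (4 * (Q * (1 + C * t * E) + 1)), by positivity, fun A hA hA₀ => ⟨by positivity, ?_⟩⟩
  have hAγ : Q * (1 + C * t * E) * A ≤ γ / 4 := piece_le hKA hA hA₀
  rw [gamma_expand]
  linarith

/-- REGISTERED SUB-GOAL `stub_bf18ShellParam` of the line `Sketch` (the order of choices `ε ↦ u ↦ Δ₀ ↦ A₀`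
in the BF18 shell): for `t, L, ε > 0` and `C, C₂ ≥ 0` there are `u ∈ (0,1)` and `Δ₀ > 0` with `4Δ₀ ≤ t`
such that for every `0 < Δ ≤ Δ₀` there is `A₀ > 0` with `0 ≤ Γ(u, Δ, A)` and `L · (Γ + √Γ) ≤ ε` for all
`0 ≤ A ≤ A₀`, where `Γ(u, Δ, A) = (2 + 1/(1 − ζ(1−u)) + 1/ζ(u))·(A + C·((C₂Δ + t(A + C·C₂·Δ))e^{Ct} + C₂Δ))
+ C₂u`. [folklore] -/
theorem stub_bf18ShellParam : ∀ (t C C₂ L ε : ℝ), 0 < t → 0 ≤ C → 0 ≤ C₂ → 0 < L → 0 < ε →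
    ∃ u Δ₀ : ℝ, 0 < u ∧ u < 1 ∧ 0 < Δ₀ ∧ 4 * Δ₀ ≤ t ∧ ∀ Δ : ℝ, 0 < Δ → Δ ≤ Δ₀ →
      ∃ A₀ : ℝ, 0 < A₀ ∧ ∀ A : ℝ, 0 ≤ A → A ≤ A₀ →
        0 ≤ (2 + 1 / (1 - Real.smoothTransition (1 - u)) + 1 / Real.smoothTransition u) *
            (A + C * ((C₂ * Δ + t * (A + C * C₂ * Δ)) * Real.exp (C * t) + C₂ * Δ)) + C₂ * u ∧
        L * ((2 + 1 / (1 - Real.smoothTransition (1 - u)) + 1 / Real.smoothTransition u) *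
            (A + C * ((C₂ * Δ + t * (A + C * C₂ * Δ)) * Real.exp (C * t) + C₂ * Δ)) + C₂ * u +
          Real.sqrt ((2 + 1 / (1 - Real.smoothTransition (1 - u)) + 1 / Real.smoothTransition u) *
            (A + C * ((C₂ * Δ + t * (A + C * C₂ * Δ)) * Real.exp (C * t) + C₂ * Δ)) + C₂ * u)) ≤ ε := by
  intro t C C₂ L ε ht hC hC₂ hL hε
  -- the budget `γ`: `x ≤ γ` gives `L (x + √x) ≤ ε`
  obtain ⟨γ, hγ0, hγb⟩ := exists_budget hL hε
  -- the choice of `u`: `C₂ u ≤ γ/4`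
  obtain ⟨u, hu0, hu1, huγ⟩ : ∃ u : ℝ, 0 < u ∧ u < 1 ∧ C₂ * u ≤ γ / 4 := by
    have hu0 : 0 < min (1 / 2) (γ / (4 * (C₂ + 1))) := lt_min (by norm_num) (by positivity)
    exact ⟨min (1 / 2) (γ / (4 * (C₂ + 1))), hu0, (min_le_left _ _).trans_lt (by norm_num),
      piece_le hC₂ hu0.le (min_le_right _ _)⟩
  -- the choices of `Δ₀` and `A₀` at the fixed bracket `Q(u) > 0`
  obtain ⟨Δ₀, hΔ₀0, hΔ₀t, hmain⟩ := tail_choice (bracket_pos hu0 hu1) (Real.exp_pos (C * t)) ht hC hC₂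
    hγ0 (mul_nonneg hC₂ hu0.le) huγ
  refine ⟨u, Δ₀, hu0, hu1, hΔ₀0, hΔ₀t, fun Δ hΔ hΔΔ₀ => ?_⟩
  obtain ⟨A₀, hA₀, hA⟩ := hmain Δ hΔ hΔΔ₀
  refine ⟨A₀, hA₀, fun A hA0 hAA₀ => ?_⟩
  obtain ⟨hΓ0, hΓγ⟩ := hA A hA0 hAA₀
  exact ⟨hΓ0, hγb _ hΓγ⟩

end Summit.AtomisticToContinuum.HydrodynamicLimit.Theorems.ChaosClosesEulerShellParam
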